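import Summits.ValiantsHypothesis.ValiantsHypothesis.Theorems.KPlusLogSqLawTropicalBVertexCount

/-!
# Route «KPlusLogSqLaw», crux `TropicalB` (stmt-ValiantsHypothesis-19771) — DEFINITIONS: the BOUNDARY-TYPE (permutation-register)
# sector and its vertex-count law, with the two counting-trivial base cases `B = 0`, `B = 1`

HONEST FRAMING.  Definitions-with-sanity-lemmas toward the registered stubs `stub_tropThin` / `stub_tropFat` of
`Cruxes/TropicalB/Lines/birth.lean` (crux `Summit.ValiantsHypothesis.ValiantsHypothesis.Theses.KPlusLogSqLaw.TropicalB`, item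
`stmt-ValiantsHypothesis-19771`, route `KPlusLogSqLaw`, DRAFT; cell `pub-symmetroid`).  Filed by seat val-sym-trop-p1 g2 at the desk's
request (lead g17 R1474 (a) / R1476 (a): «the permutation-register SECTOR theorem in vertex-count currency — trop-p1 states, the trop-p2
successor proves»), in the vertex-count currency of val-sym-trop-p2's normal form (`tropicalB_iff_cardDominant`, file
`…TropicalBVertexCount`: `TropicalB` ⟺ every design has `≤ 2^{C(K+⌊log₂m⌋²)}` integer-exposed dominant terms) and following
val-sym-trop-p2 g2's memo HOME/val-sym-trop-p2/g2/REGISTERS-g2.md §R11–R12 («boundary-type presence»).  NOTHING in-window is proved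
here: `BoundaryVertexLaw` is a sector TARGET (a `Prop` with parameters, not asserted); the two theorems are its counting-trivial
base cases.  Nothing bears on `TropicalB`, `KPlusLogSqLaw`, `Lifting`, DoorA26 / DoorA34, `MatrixDescartes` (`stmt-ValiantsHypothesis-18050`)
or VP ≠ VNP.

THE SECTOR.  A BOUNDARY-TYPE design with `B` boundaries on `m` nodes: `B` pairs of orders, given as permutations
`π ρ : Fin B → Equiv.Perm (Fin m)`; the entry `(a, b)` has the boundary PATTERN `pattern π ρ a b : Fin B → Bool`,
`j ↦ [π j a < ρ j b]`; a labelling `lab : (Fin B → Bool) → Fin K` names the class of each pattern; the design `(d, v, ε)` is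
boundary-type (`IsBoundaryDesign π ρ lab ε`) when every entry carries EXACTLY the class of its pattern (`ε a b l ≠ 0 ↔ l = lab (pattern a b)`)
— exponents `d` and valuations `v` ARBITRARY.  This is the cell's family of «permutation registers»: `B = 1`, `π = ρ = id` is the
wrap boundary `[a < b]` of the rotations (circulant / SHIFT-type backbones, torus factors); `B = 2` adds a second, incommensurable
boundary `[π a < ρ b]` (REGISTERS-g2 R11 (c)); Toeplitz-with-wrap and torus designs are boundary-type for small `B`.
`BoundaryVertexLaw B e` := ONE constant `C` bounds the number of integer-exposed dominant terms of every boundary-type design with `B`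
boundaries by `C·(m+1)^e`, uniformly in `m`, the orders, the labelling, `K`, `d`, `v`.

STATUS / TARGET.  Counting (`tropRowD_choose` + `card_dominant_le_succ`) gives exponent `2^B − 1` when `lab` is injective on the
`2^B` patterns (a present term's slope is determined by its pattern counts); `B = 0` (`boundaryVertexLaw_zero`: at most ONE exposed
term) and `B = 1` (`boundaryVertexLaw_one`: at most `m + 1`) are proved below.  The SECTOR THEOREM the desk asks for (trop-p2 successor):
`BoundaryVertexLaw 2 2` — two incommensurable boundaries with four generic exponents carry only quadratically many exposed terms
(counting allows `(m+1)³`; REGISTERS-g2 R11 (b)–(c) locates why zero-sum deviations of one cyclic order are slope-invisible and conjectures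
`poly_B`); the in-window form relevant to `TropicalB` is «exponent linear in `B`»: `∀ B, BoundaryVertexLaw B (c·B)` for an absolute `c`
(`K = 2^B` classes ⇒ `(m+1)^{cB} = 2^{c·log₂K·log₂(m+1)} ≤ 2^{c(K + ⌊log₂m⌋²)}`-shape), versus counting's `2^B − 1`.
A refutation of `BoundaryVertexLaw 2 2` (a two-boundary family with super-quadratically many exposed terms) would be the first
non-path super-quadratic register mechanism (R11 (c) test bed).
-/

-- `Summit.ValiantsHypothesis.ValiantsHypothesis.…` repeats a component by the D-0017 layout
-- (single-conjunct summit), which the `dupNamespace` linter flags; the name is mandated.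
set_option linter.dupNamespace false
set_option autoImplicit false

namespace Summit.ValiantsHypothesis.ValiantsHypothesis.Theorems.KPlusLogSqLaw

open Summit.ValiantsHypothesis.ValiantsHypothesis.Theorems.MatrixDescartes.Negative
open Summit.ValiantsHypothesis.ValiantsHypothesis.Theorems.LacunarySymmetroidMatrixDescartes
open Finset

namespace BoundarySector

variable {m K B : ℕ}

/-- The boundary PATTERN of the entry `(a, b)` under `B` pairs of orders `(π j, ρ j)`: `j ↦ [π j a < ρ j b]`.
[definition of the cell: REGISTERS-g2 §R11–R12 «boundary-type presence»] -/
def pattern (π ρ : Fin B → Equiv.Perm (Fin m)) (a b : Fin m) : Fin B → Bool := fun j => decide (π j a < ρ j b)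

/-- BOUNDARY-TYPE design: every entry `(a, b)` carries exactly the class `lab (pattern π ρ a b)` of its boundary pattern (signs free,
exponents and valuations unconstrained). [definition of the cell] -/
def IsBoundaryDesign (π ρ : Fin B → Equiv.Perm (Fin m)) (lab : (Fin B → Bool) → Fin K)
    (ε : Fin m → Fin m → Fin K → ℤ) : Prop :=
  ∀ a b l, ε a b l ≠ 0 ↔ l = lab (pattern π ρ a b)

open Classical in
/-- **BOUNDARY VERTEX LAW** with `B` boundaries and exponent `e` (a sector TARGET, not asserted): one constant `C` such that every
boundary-type design with `B` boundaries on `m` nodes has at most `C·(m+1)^e` integer-exposed dominant terms (vertex-count currency of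
`tropicalB_iff_cardDominant`), for all `m`, orders, labellings, `K`, exponents and valuations. [definition of the cell] -/
def BoundaryVertexLaw (B e : ℕ) : Prop :=
  ∃ C : ℕ, ∀ (m K : ℕ) (π ρ : Fin B → Equiv.Perm (Fin m)) (lab : (Fin B → Bool) → Fin K) (d : Fin K → ℕ)
    (v ε : Fin m → Fin m → Fin K → ℤ), IsBoundaryDesign π ρ lab ε →
    (univ.filter fun q : Equiv.Perm (Fin m) × (Fin m → Fin K) => ∃ t : ℤ, IsDominant d v ε t q).card ≤ C * (m + 1) ^ e

/-! ## Sanity: present terms of a boundary-type design read their classes off the patterns -/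

/-- In a boundary-type design a present term uses, in every column, the class of the entry's pattern. [folklore] -/
theorem class_eq_of_present {π ρ : Fin B → Equiv.Perm (Fin m)} {lab : (Fin B → Bool) → Fin K}
    {ε : Fin m → Fin m → Fin K → ℤ} (hε : IsBoundaryDesign π ρ lab ε) {q : Equiv.Perm (Fin m) × (Fin m → Fin K)}
    (hq : termSign ε q ≠ 0) (b : Fin m) : q.2 b = lab (pattern π ρ (q.1 b) b) :=
  (hε (q.1 b) b (q.2 b)).1 ((termSign_ne_zero_iff ε q).1 hq b)

/-- Hence the slope of a present term is the sum over the columns of the exponent of the pattern class. [folklore] -/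
theorem slope_eq_of_present {π ρ : Fin B → Equiv.Perm (Fin m)} {lab : (Fin B → Bool) → Fin K} (d : Fin K → ℕ)
    {ε : Fin m → Fin m → Fin K → ℤ} (hε : IsBoundaryDesign π ρ lab ε) {q : Equiv.Perm (Fin m) × (Fin m → Fin K)}
    (hq : termSign ε q ≠ 0) :
    TropicalCensus.slope d q = ∑ b, (d (lab (pattern π ρ (q.1 b) b)) : ℤ) := by
  unfold TropicalCensus.slope
  exact sum_congr rfl fun b _ => by rw [class_eq_of_present hε hq b]

/-! ## Base case `B = 0`: one class everywhere, at most one exposed term -/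

/-- With no boundary all patterns coincide, so every present term has slope `m · d (lab ⋆)`. [folklore] -/
theorem slope_eq_of_zero {π ρ : Fin 0 → Equiv.Perm (Fin m)} {lab : (Fin 0 → Bool) → Fin K} (d : Fin K → ℕ)
    {ε : Fin m → Fin m → Fin K → ℤ} (hε : IsBoundaryDesign π ρ lab ε) {q : Equiv.Perm (Fin m) × (Fin m → Fin K)}
    (hq : termSign ε q ≠ 0) : TropicalCensus.slope d q = m * (d (lab fun j => j.elim0) : ℤ) := by
  rw [slope_eq_of_present d hε hq]
  have hp : ∀ b, pattern π ρ (q.1 b) b = fun j => j.elim0 := fun b => funext fun j => j.elim0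
  simp only [hp, sum_const, card_univ, Fintype.card_fin, nsmul_eq_mul]

/-- **`B = 0`: `BoundaryVertexLaw 0 0`** — a boundary-type design without boundaries has at most one integer-exposed dominant term
(all present terms have the same slope, and distinct exposed terms have distinct slopes). [folklore] -/
theorem boundaryVertexLaw_zero : BoundaryVertexLaw 0 0 := by
  classical
  refine ⟨1, fun m K π ρ lab d v ε hε => ?_⟩
  have hrow : DesignRowD d v ε 0 := by
    intro n θ p hθ hdom hne
    by_contra hn
    have hn' : 0 < n := Nat.pos_of_ne_zero (by omega)
    have hsm := slope_strictMono_of_chainD d v ε θ p hθ hdom hne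
    have hlt := hsm (show (⟨0, by omega⟩ : Fin (n + 1)) < ⟨1, by omega⟩ from Fin.mk_lt_mk.2 Nat.zero_lt_one)
    simp only at hlt
    rw [slope_eq_of_zero d hε (hdom _).1, slope_eq_of_zero d hε (hdom _).1] at hlt
    exact lt_irrefl _ hlt
  simpa using card_dominant_le_succ d v ε hrow

/-! ## Base case `B = 1`: the wrap-type boundary, at most `m + 1` exposed terms -/

/-- With one boundary the pattern of an entry is `true` or `false` everywhere according to `[π 0 a < ρ 0 b]`. [folklore] -/
theorem pattern_one (π ρ : Fin 1 → Equiv.Perm (Fin m)) (a b : Fin m) :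
    pattern π ρ a b = if π 0 a < ρ 0 b then (fun _ => true) else (fun _ => false) := by
  funext j
  have hj : j = 0 := Fin.eq_zero j
  subst hj
  unfold pattern
  split_ifs with h <;> simp [h]

/-- With one boundary the slope of a present term is affine in the number of columns on the `true` side:
`slope = m · d₀ + (d₁ − d₀) · #{b : π 0 (σ b) < ρ 0 b}`. [folklore] -/
theorem slope_eq_of_one {π ρ : Fin 1 → Equiv.Perm (Fin m)} {lab : (Fin 1 → Bool) → Fin K} (d : Fin K → ℕ)
    {ε : Fin m → Fin m → Fin K → ℤ} (hε : IsBoundaryDesign π ρ lab ε) {q : Equiv.Perm (Fin m) × (Fin m → Fin K)}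
    (hq : termSign ε q ≠ 0) :
    TropicalCensus.slope d q = m * (d (lab fun _ => false) : ℤ) +
      ((d (lab fun _ => true) : ℤ) - d (lab fun _ => false)) * (univ.filter fun b : Fin m => π 0 (q.1 b) < ρ 0 b).card := by
  classical
  rw [slope_eq_of_present d hε hq]
  have e : ∀ b : Fin m, (d (lab (pattern π ρ (q.1 b) b)) : ℤ) =
      if π 0 (q.1 b) < ρ 0 b then (d (lab fun _ => true) : ℤ) else (d (lab fun _ => false) : ℤ) := by
    intro b
    rw [pattern_one]
    split_ifs <;> rfl
  rw [sum_congr rfl (fun b _ => e b), sum_ite, sum_const, sum_const, nsmul_eq_mul, nsmul_eq_mul]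
  have hc : ((univ.filter fun b : Fin m => ¬ π 0 (q.1 b) < ρ 0 b).card : ℤ) =
      m - (univ.filter fun b : Fin m => π 0 (q.1 b) < ρ 0 b).card := by
    have := card_filter_add_card_filter_not (s := (univ : Finset (Fin m))) (fun b : Fin m => π 0 (q.1 b) < ρ 0 b)
    rw [card_univ, Fintype.card_fin] at this
    omega
  rw [hc]
  ring

/-- **`B = 1`: `BoundaryVertexLaw 1 1`** — a boundary-type design with ONE boundary (e.g. the wrap boundary `[a < b]` of every
rotation/circulant backbone) has at most `m + 1` integer-exposed dominant terms: along an exposed chain the slopes strictly increase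
and are an affine image of the count `#{b : π 0 (σ b) < ρ 0 b} ∈ [0, m]`. [folklore] -/
theorem boundaryVertexLaw_one : BoundaryVertexLaw 1 1 := by
  classical
  refine ⟨1, fun m K π ρ lab d v ε hε => ?_⟩
  have hrow : DesignRowD d v ε m := by
    intro n θ p hθ hdom hne
    have hsm := slope_strictMono_of_chainD d v ε θ p hθ hdom hne
    -- the count map is injective along the chain
    let c : Fin (n + 1) → ℕ := fun k => (univ.filter fun b : Fin m => π 0 ((p k).1 b) < ρ 0 b).card
    have hcinj : Function.Injective c := by
      intro k k' h
      apply hsm.injective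
      simp only
      rw [slope_eq_of_one d hε (hdom k).1, slope_eq_of_one d hε (hdom k').1]
      simp only [c] at h
      rw [h]
    have hcle : ∀ k, c k < m + 1 := fun k =>
      Nat.lt_succ_of_le ((card_filter_le _ _).trans (by rw [card_univ, Fintype.card_fin]))
    have hinj' : Function.Injective fun k : Fin (n + 1) => (⟨c k, hcle k⟩ : Fin (m + 1)) := by
      intro k k' h
      exact hcinj (by simpa using congrArg Fin.val h)
    have := Fintype.card_le_of_injective _ hinj'
    simp only [Fintype.card_fin] at this
    omega
  simpa using card_dominant_le_succ d v ε hrow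

end BoundarySector

end Summit.ValiantsHypothesis.ValiantsHypothesis.Theorems.KPlusLogSqLaw
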